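import Summits.AnomalousDissipation.AnomalousDissipation.Theorems.FloorCertificate.Negative.Uniform
import Literature.Analysis.FluidPDE.EnergySpaceRellich
import Literature.Analysis.FluidPDE.CylindricalGenerator
import Mathlib.MeasureTheory.Measure.Prokhorov

/-!
# Line `floor-minimax-dissipation-tightness` for crux `TaylorCertificates.FloorCertificate` (stmt-AnomalousDissipation-14091) — generation 2

planner-cruxplan-stmt-AnomalousDissipation-14091-floor-minimax-dissip-g2-0 · crux-plan (opening, round 1,
GENERATION 2) · 2026-08-16. Idea card `Cruxes/FloorCertificate/Ideas/floor-minimax-dissipation-tightness.md`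
(ideator 3; triage r1-1 / r1-2 / r1-3: pass ×3, named CARRIER of the merge `dissipation-deficit-duality ≈
dissipation-tight-minimax ≈ floor-minimax-dissipation-tightness`). Line card: `Lines/floor-minimax-dissipation-tightness.md`.
Supersedes the generation-1 skeleton of the same path (planner-cruxplan-…-floor-minimax-dissip-0, 6 stubs over
LOCAL named `Prop`s). WHAT GENERATION 2 CHANGES, and why:

* TREE VOCABULARY ONLY in every stub signature (as in the PICKED line's reshape 1,
  `Lines/dissipation-deficit-duality.lean`): a registered stub is matched by NAME + SIGNATURE TEXT when a
  `Theorems/… --supports stmt-AnomalousDissipation-14091` file lands it, so a stub typed by a `Prop` that only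
  this sorried file defines (`DissipationSublevelCompact`, `FanMinimax`, … in generation 1) can never be landed.
  The local names survive below as DEFINITIONAL abbreviations (`LscEnstrophy`, `DissipationSublevelCompact`,
  `FanMinimax`, `LopsidedMinimax`, `CylindricalCombination`, `FloorMinimax`, `RelaxedEnsembleFloor`) and the
  wiring `FloorCertificate_of_stubs := FloorCertificate_of stub_… …` kernel-checks that each expanded stub IS the
  named statement.
* FIVE OF THE SEVEN STUBS ARE VERBATIM (name and signature) THE LEAD'S REGISTERED STUBS of the picked sibling
  line (`prover-line-stmt-AnomalousDissipation-14091-0`, reshape 1, skeleton sha `5209c1…`): S0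
  `stub_lscEnstrophy`, S1 `stub_sublevelCompact`, S2 `stub_fanMinimax`, S3a `stub_cylindricalCombination`, S5
  `stub_relaxedEnsembleFloor` — ONE proof serves both lines whichever skeleton is the item's active
  registration. Only S3 `stub_lopsided_of_fan` (THE CARD'S LEVER: Fan ⇒ inf-compact/lopsided minimax) and S4
  `stub_floorMinimax` (its instantiation: strong duality for floors on EVERY ball radius `ρ`) are this line's
  own; they replace the sibling's S3 `stub_minimaxAlternative` (slope-bounded multipliers) + S4
  `stub_penalisationLimit` (approximate statistics) — same theorem, no slope bounds, no penalisation, no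
  approximate statistics, and `ρ` free (the duals of trap-restricted or graded certificate classes live on other
  balls).
* S0 (lower semicontinuity of the mean enstrophy) is factored out of generation 1's S1/S5, exactly as the lead
  factored it: S1 and S4 both consume it.

## The line in one paragraph — DISSIPATION IS ITS OWN TIGHTNESS

At fixed `ν > 0` read the crux on a ball `B_ρ = {u ∈ H : |u|² ≤ ρ}` as a game between CERTIFICATES
`y = (Φ, θ)` (`Φ` cylindrical, `θ ≤ 0`) and RELAXED STATIONARY STATISTICS — Borel probability measures
`μ` on `H` carried by the ball with finite mean enstrophy — with payoff the mean Lagrangian `∫ L_y dμ`,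
`L_y(u) = D + ⟨F_ν(u),Φ'(u)⟩ + 2θ((u,f) − D)`, `D = ν‖∇u‖²` (verbatim the crux's right-hand side). The
payoff is affine in both variables, lower semicontinuous in `μ` (narrow topology: the generator pairing and
the work are norm-continuous and bounded ON THE BALL — tree `Torus.continuous_nsGeneratorPairing_grad`,
`Torus.exists_abs_nsGeneratorPairing_grad_le` —, the mean enstrophy is lsc — S0, from tree
`Torus.lowerSemicontinuous_eGradNormSq_coe`), and at the ONE certificate `y₀ = (0, 0)` it is INF-COMPACT:
`{μ : ∫ L_{y₀} dμ ≤ c} = {μ : ν∫‖∇u‖²dμ ≤ c}` is narrowly compact because dissipation sublevel sets are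
tight (Markov + Rellich, tree `Torus.isCompact_setOf_eGradNormSq_le`) and closed (S1). A LOPSIDED minimax
theorem — Ky Fan's convex-like minimax (S2) upgraded by a finite-intersection argument from "`X` compact"
to "one sublevel family of `φ(·, y₀)` compact" (S3; Aubin, Optima and Equilibria, Thm 8.1 / Prop 8.3 /
Exercise 8.1) — then exchanges `sup_y` and `inf_μ` with NO GAP: `sup_{Φ,θ} inf_u L = min_μ sup_{Φ,θ} ∫L dμ`.
Convexity of the certificate class ON THE BALL (S3a: `aΦ₁' + bΦ₂'` is the differential of ONE
`CylindricalTest` on `B_ρ` after a `C¹_c` re-cut-off) makes the right-hand `sup` equal to `ν∫‖∇u‖²dμ` on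
relaxed stationary statistics and `+∞` off them, and Dirac masses at finite-enstrophy ball states evaluate
the left-hand `inf` (S4 = the instantiation, conclusion `FloorMinimax`): if every relaxed stationary
statistic on `B_ρ` dissipates `≥ ε`, some `(Φ, θ ≤ 0)` certifies the floor `ε − δ` pointwise, for every
`δ > 0`. The crux follows from ONE physics statement in dual form (S5 `RelaxedEnsembleFloor`, OPEN: some
force all of whose relaxed stationary statistics on the Leray balls are uniformly loud as `ν → 0`) by
`FloorCertificate_of` (kernel-checked logic: answer with `ε₀/2`, `δ = ε₀/2`, `ρ = 16‖f‖²/ν²`). EXACTNESS (no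
costume): `relaxedEnsembleFloor_of_floorCertificate` (PROVED, weak duality for the relaxed class at every
radius) — S5 is NECESSARY for the crux and, given S0–S4, equivalent to it.

Stub set (7): S0 `stub_lscEnstrophy` (M, = sibling S0) · S1 `stub_sublevelCompact` (M, = sibling S1) · S2
`stub_fanMinimax` (M–L, = sibling S2) · S3a `stub_cylindricalCombination` (M, = sibling S3a) · S3
`stub_lopsided_of_fan` (M; THIS card's lever) · S4 `stub_floorMinimax` (L; hardest provable-now) · S5
`stub_relaxedEnsembleFloor` (OPEN; hardest; = sibling S5).

Disproof.lean (cdisprove v2, §A–§F, unchanged since 2026-08-16T01:42Z, re-read 04:40Z; landed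
`Negative/{WeakDuality, UniformTools, Uniform}.lean`, imported here through `Negative.Uniform`): no kill, NO
`_false_without_<H>` theorem is published (§F makes no sorried claim), so there is no obligatory hypothesis
to honour; what the file establishes is honoured as follows. §C `floorFamily_le_ensembleDissipation` /
`floorCertificate_false_of_quietStatistics`: `weak_duality` below is its relaxed-class, every-radius form,
and S0–S4 prove the CONVERSE at fixed `ν` — the disprover's `QuietStatistics` (for the witness force,
relaxed class) is thereby NECESSARY AND SUFFICIENT for `¬FloorCertificate`, i.e. S5 is exactly the statement
a disprover must refute. §B `floor_at_rest`: `δ₀` lies in the minimax domain, so every certificate produced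
by S4 pushes against `f` at rest automatically. §D `floor_at_quiet_euler_point` (the `1/ν` demand at smooth
quiet Euler points): met because the certificate class of S4 is the FULL cylindrical class with unbounded
weights; by the minimax a family of quiet Euler POINTS refutes nothing unless an EXACT quiet relaxed
statistic exists (`δ_v` is not Liouville: `∫⟨F_ν,Φ'⟩dδ_v = −ν‖∇v‖²` at `Φ' = v`). §E
`not_floorCertificateUniform` (landed Negative lemma, imported): every certificate here depends on `ν`
through `ρ = 16‖f‖²/ν²` and through S5's `ν`-dependent dual bound — no stub is an instance of the refuted
`FloorCertificateUniform`, and S4 at fixed `ν` says nothing about `ν`-uniform multipliers (their dual would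
live on the union of the balls, which is not tight). Disproof v3 (gen-2 disprover, evidence note
2026-08-16T04:37Z; tree copy still v2 when this file was published; landing announced as
`Negative/{InjectedBeatTools, InjectedBeat, FixedResolution}.lean`): NEW §F `not_floorCertificateFixedResolution`
(PROVED) — no floor certificate of BOUNDED RESOLUTION (test fields of `ν`-independent trigonometric degree `N`,
profile / number of fields / weight free) exists for ANY force; quantitative core `floor_fails_at_fixed_resolution`,
`floor_witness_exceeds_resolution`; §G `witness_requirements` (`f ≠ 0`, all steady states / SSS `ε₀`-loud,
resolution of the multipliers `→ ∞` as `ν → 0`); §H a sorried near-miss. Honoured: S4 draws its certificate from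
the FULL cylindrical class at each `ν` (arbitrary smooth test fields, no degree bound, `ν`-dependent), so no stub
is an instance of the refuted fixed-resolution strengthening and the composition's witnesses meet §G by
construction (`f ≠ 0` and loud steady states / SSS follow from S5 via `weak_duality`); read through the GRADED form
of S4 (same proof with `P_N`-valued test fields, a sub-class closed under S3a's operations) §F says exactly that for
every fixed `N` quiet `N`-relaxed statistics (Liouville only for band-`N` tests) exist as `ν → 0` — a statement
about band-limited duals, not about S5 (`N = ∞`). Still NO `_false_without_<H>` theorem. Negatives index
(`ledger negatives`, 4 items: 13037 ceiling pair, 2979/2984 FrustratedForces drift data, 2859 DebrisQuanta):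
none is a floor or a duality statement; nothing refuted is restated.
-/

noncomputable section

set_option linter.dupNamespace false

namespace Summit.AnomalousDissipation.AnomalousDissipation.Cruxes.FloorCertificate.FloorMinimaxDissipationTightness

open MeasureTheory Filter Topology UnitAddTorus
open scoped InnerProductSpace ENNReal
open Literature.Analysis.FunctionSpaces Literature.Analysis.FluidPDE
open Summit.AnomalousDissipation.AnomalousDissipation.Theses.TaylorCertificates
open Summit.AnomalousDissipation.AnomalousDissipation.Theorems.FloorCertificate.Negative

/-- Local notation: real vector fields on `T³`. -/
local notation "Vec3" => (UnitAddTorus (Fin 3)) → (EuclideanSpace ℝ (Fin 3))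
/-- Local notation: `L²(T³; ℝ³)`. -/
local notation "L2" => (Lp (EuclideanSpace ℝ (Fin 3)) 2 (volume : Measure (UnitAddTorus (Fin 3))))
/-- Local notation: the energy space `H` (Borel σ-algebra from `StatisticalSolution.lean`). -/
local notation "H3" => (Torus.energySpace (Fin 3))

/-! ## The stubs S0–S5 (the only `sorry`s of the file) — tree vocabulary only -/

/-- **S0 `stub_lscEnstrophy`** (VERBATIM the sibling line's S0 — prove once) — the mean enstrophy
`μ ↦ ∫⁻ ‖∇u‖² dμ` is LOWER SEMICONTINUOUS on `ProbabilityMeasure H` (topology of weak convergence). WHY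
TRUE: the spectral enstrophy `u ↦ ‖∇u‖² = 4π² Σₖ |k|² ‖û(k)‖²` is the directed supremum, over finite
frequency sets `s` and caps `N : ℕ`, of the BOUNDED CONTINUOUS functions
`h_{s,N}(u) = min(N, 4π² Σ_{k∈s} |k|²‖û(k)‖²)` (each `u ↦ û(k)` is continuous on `H`:
`Torus.continuous_mFourierCoeff_complexify_coe`, cf. the proof of `Torus.lowerSemicontinuous_eGradNormSq_coe`
in `EnergySpaceRellich.lean`); `μ ↦ ∫⁻ h_{s,N} dμ` is continuous (`FiniteMeasure.continuous_testAgainstNN_eval`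
∘ `ProbabilityMeasure.toFiniteMeasure_continuous`), the supremum commutes with `∫⁻`
(`lintegral_iSup_directed_of_measurable`, countable index), and a supremum of continuous functions is lower
semicontinuous (`lowerSemicontinuous_iSup`). Size M. Consumed by S1 (closedness) and S4 (lsc of the payoff). -/
theorem stub_lscEnstrophy :
    LowerSemicontinuous fun μ : ProbabilityMeasure (Torus.energySpace (Fin 3)) =>
      Torus.ensembleEnstrophy (μ : Measure (Torus.energySpace (Fin 3))) := by
  sorry

/-- **S1 `stub_sublevelCompact`** (VERBATIM the sibling line's S1 — prove once) — DISSIPATION IS ITS OWN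
TIGHTNESS: given S0, for every radius `ρ` and finite level `c` the probability measures carried by the ball
`{|u|² ≤ ρ}` with mean enstrophy `≤ c` form a COMPACT subset of `ProbabilityMeasure H`. WHY TRUE: TIGHT —
for `μ` in the set and `t > 0`, `K_t = {|u|² ≤ ρ} ∩ {‖∇u‖² ≤ t}` is norm-compact in `H` (Rellich
`Torus.isCompact_setOf_eGradNormSq_le` ∩ closed ball) and `μ(K_tᶜ) ≤ μ{‖∇u‖² > t} ≤ c/t` (Markov
`mul_meas_ge_le_lintegral₀`, `Torus.measurable_eGradNormSq_coe`; the tree's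
`Literature.Probability.Process.KrylovBogoliubov.isTightMeasureSet_of_lintegral_le` is this step); relatively
compact by Prokhorov (Mathlib `isCompact_closure_of_isTightMeasureSet`, T2 + Borel suffice); CLOSED —
`{∫⁻‖∇u‖² ≤ c}` is a sublevel set of the lsc map S0 (`LowerSemicontinuous.isClosed_preimage`), and "carried by
the closed ball" is closed under weak limits along any filter (portmanteau
`ProbabilityMeasure.limsup_measure_closed_le_of_tendsto` with the closed ball: `1 = limsup μ'(ball) ≤ μ(ball)`);
conclude with `IsCompact.of_isClosed_subset`. If `ρ < 0` the set is empty. Size M.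
[FMRT2001 Ch. IV §3 (tightness of time averages); Krylov–Bogoliubov 1937.] -/
theorem stub_sublevelCompact :
    (LowerSemicontinuous fun μ : ProbabilityMeasure (Torus.energySpace (Fin 3)) =>
      Torus.ensembleEnstrophy (μ : Measure (Torus.energySpace (Fin 3)))) →
    ∀ (ρ : ℝ) (c : ℝ≥0∞), c ≠ ⊤ →
      IsCompact {μ : ProbabilityMeasure (Torus.energySpace (Fin 3)) |
        (∀ᵐ u ∂(μ : Measure (Torus.energySpace (Fin 3))), ‖u‖ ^ 2 ≤ ρ) ∧
          Torus.ensembleEnstrophy (μ : Measure (Torus.energySpace (Fin 3))) ≤ c} := by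
  sorry

/-- **S2 `stub_fanMinimax`** (VERBATIM the sibling line's S2 — prove once; third consumer: the
AtomisticToContinuum crux line `almost-invariant-duality`, stub `CorrectorMinimax`) — KY FAN'S CONVEX-LIKE
MINIMAX PRINCIPLE (Fan 1953, Thm 2; `γ`-form, no topology on `Y`): `X` compact, `Y` nonempty, `φ(·, y)` lower
semicontinuous, `φ` convex-like in `x` and concave-like in `y`; if every `x` is beaten by some `y` above the
level `γ`, ONE `y` beats every `x` above `γ`. WHY TRUE = Fan's proof: the closed sets `C_y = {x : φ(x,y) ≤ γ}`
have empty intersection, so by compactness finitely many `y₁ … yₙ` give `maxᵢ φ(x, yᵢ) > γ` for all `x`,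
indeed `≥ β > γ` (an lsc function attains its minimum on a compact space; `X = ∅` is trivial by `Nonempty Y`);
the set `E = {z ∈ ℝⁿ : ∃ x, ∀ i, φ(x,yᵢ) ≤ zᵢ}` is convex (convex-likeness in `x`) and misses the open convex
box `{z : ∀ i, zᵢ < β}`; separate (`geometric_hahn_banach_open` in `ℝⁿ`; template: the tree's finite von
Neumann theorem `Literature.Analysis.Convex.MinMax.exists_mixed_of_forall_mixed_lt`): the functional has
nonnegative weights (E is an upper set), normalise to `λ ∈ Δₙ` with `Σλᵢ φ(x,yᵢ) ≥ β` for all `x`;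
concave-likeness in `y`, iterated to `n` points by induction on `n`, gives `y₀` with
`φ(x, y₀) ≥ Σλᵢ φ(x,yᵢ) ≥ β > γ` for all `x`. No Hausdorff assumption is used. Size M–L; printed proofs in
hand: Aubin, Optima and Equilibria (1993) Props 8.2–8.3 / Thm 8.1 (held), Grafakos 2008 App. H (held).
[Fan, Proc. Nat. Acad. Sci. USA 39 (1953) 42–47, Thm 2; Sion, Pacific J. Math. 8 (1958) 171–176; König,
Arch. Math. 19 (1968) 482–487.] -/
theorem stub_fanMinimax :
    ∀ (X Y : Type) [TopologicalSpace X] [CompactSpace X] [Nonempty Y] (φ : X → Y → ℝ),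
      (∀ y : Y, LowerSemicontinuous fun x : X => φ x y) →
      (∀ (x₁ x₂ : X) (t : ℝ), 0 ≤ t → t ≤ 1 → ∃ x₀ : X, ∀ y : Y, φ x₀ y ≤ t * φ x₁ y + (1 - t) * φ x₂ y) →
      (∀ (y₁ y₂ : Y) (t : ℝ), 0 ≤ t → t ≤ 1 → ∃ y₀ : Y, ∀ x : X, t * φ x y₁ + (1 - t) * φ x y₂ ≤ φ x y₀) →
      ∀ γ : ℝ, (∀ x : X, ∃ y : Y, γ < φ x y) → ∃ y : Y, ∀ x : X, γ < φ x y := by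
  sorry

/-- **S3a `stub_cylindricalCombination`** (VERBATIM the sibling line's S3a — prove once) — LINEAR
COMBINATIONS OF CYLINDRICAL TEST FUNCTIONALS ARE REALISED ON EVERY BALL: for reals `a, b`, a radius² `ρ` and
cylindrical `Φ₁, Φ₂` there is ONE cylindrical `Φ₀` with `Φ₀'(u) = aΦ₁'(u) + bΦ₂'(u)` (as test fields) at
every `u` with `|u|² ≤ ρ`. WHY TRUE: concatenate the coordinates (`m₀ = m₁ + m₂`, `g₀ = Fin.append g₁ g₂` via
`Fin.addCases`; smooth, solenoidal, mean-zero componentwise), take the profile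
`φ₀(z) = χ(z)·(a φ₁(π₁ z) + b φ₂(π₂ z))` with `π₁, π₂` the coordinate projections (continuous linear) and
`χ` a `ContDiffBump` centred at `0` with `rIn` larger than the coordinate box of the ball
(`|(u, gᵢ)| ≤ |u|‖gᵢ‖_{L²}`, `Torus.abs_pairing_coe_le`): `φ₀ ∈ C¹_c` (`HasCompactSupport.mul_right`), and on
the ball `χ ≡ 1` near `coords₀ u` so `fderiv φ₀ = a (fderiv φ₁ ∘ π₁) + b (fderiv φ₂ ∘ π₂)`
(`Filter.EventuallyEq.fderiv_eq`, chain rule), whence `Φ₀'(u) = Σᵢ ∂ᵢφ₀ g₀ᵢ = aΦ₁'(u) + bΦ₂'(u)`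
(`Fin.sum_univ_add`; `CylindricalTest.grad` is the finite sum `Σᵢ ∂ᵢφ(coords u) • gᵢ`). With `a = b = 0`
it yields a test functional flat on the ball (the zero multiplier); with `b = 0` the scaling `Φ ↦ aΦ`; with
`(a, b) = (t, 1−t)` convex combinations — the three uses S4 makes of it, together with the tree's linearity
`Torus.nsGeneratorPairing_sum_smul` of the tested generator in the test field. For `ρ < 0` the ball is empty.
Size M. [FMRT2001 Ch. IV §1.2 Def. 1.2 (the class of cylindrical test functionals), p. 197.] -/
theorem stub_cylindricalCombination :
    ∀ (ρ a b : ℝ) (Φ₁ Φ₂ : Torus.CylindricalTest (Fin 3)), ∃ Φ₀ : Torus.CylindricalTest (Fin 3),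
      ∀ u : Torus.energySpace (Fin 3), ‖u‖ ^ 2 ≤ ρ → Φ₀.grad u = a • Φ₁.grad u + b • Φ₂.grad u := by
  sorry

/-- **S3 `stub_lopsided_of_fan`** — size M, provable now, pure topology/convexity over Mathlib (no fluid
vocabulary); THE CARD'S LEVER in abstract form: Ky Fan's principle (the hypothesis, = S2 verbatim) implies the
LOPSIDED (inf-compact) minimax principle — the same `γ`-form exchange WITHOUT compactness of `X`, assuming
instead that for ONE `y₀` every sublevel set `{x : φ x y₀ ≤ c}` is compact ("inf-compactness at `y₀`").
WHY TRUE (finite-intersection argument; Aubin 1993 Prop. 8.3 + Exercise 8.1 with `n = 1`): WLOG `X ≠ ∅`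
(else the conclusion holds with any `y`, `Y` nonempty). Suppose the conclusion fails: `∀ y ∃ x, φ x y ≤ γ`.
CLAIM: some `x̄` has `φ x̄ y ≤ γ` for EVERY `y` — contradicting the hypothesis at `x̄`. Proof of the claim: put
`K_c := {x : φ x y₀ ≤ c}` (compact by inf-compactness; closed as `φ(·,y₀)` is lsc) and
`A_y := {x ∈ K_γ : φ x y ≤ γ}` (closed in `K_γ`). FINITE-INTERSECTION PROPERTY: given `y₁ … y_k`, apply the
hypothesis (Fan) in MIRROR form to the game on the standard simplex `Δ = stdSimplex ℝ (Fin (k+1))` (a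
`CompactSpace` as a subtype, Mathlib `isCompact_stdSimplex` + `isCompact_iff_compactSpace`) against `X` in the
role of the nonempty parameter set: `ψ(λ, x) := −Σᵢ λᵢ φ(x, yᵢ)` (`i = 0 … k`, `y₀` INCLUDED) is continuous in
`λ`, convex-like in `λ` (take `λ₀ = tλ₁ + (1−t)λ₂ ∈ Δ`, equality) and concave-like in `x` (the
convex-likeness of `φ` in `x` supplies ONE `x₀` serving all `yᵢ` simultaneously; the weights are `≥ 0`); for
every `λ ∈ Δ` the concave-likeness of `φ` in `y`, iterated over the `k+1` points by induction, gives `y_λ` with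
`Σλᵢφ(x,yᵢ) ≤ φ(x,y_λ)` for all `x`, and the failing conclusion at `y_λ` gives `x` with
`Σλᵢφ(x,yᵢ) ≤ γ < γ + ε`, i.e. `ψ(λ, x) > −γ − ε`; so Fan at level `−γ − ε` yields, for every `ε > 0`, ONE
`x_ε` with `ψ(λ, x_ε) > −γ − ε` for all `λ ∈ Δ`, in particular (vertices) `φ(x_ε, yᵢ) < γ + ε` for all
`i ≤ k`. The `x_ε`, `ε ≤ 1`, lie in the compact `K_{γ+1}`; the closed sets
`{x ∈ K_{γ+1} : ∀ i ≤ k, φ(x,yᵢ) ≤ γ + 1/n}` are nonempty and decreasing in `n`, so their intersection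
(`IsCompact.nonempty_iInter_of_directed_nonempty_isCompact_isClosed`, or `IsCompact.inter_iInter_nonempty`)
contains an `x` with `φ(x, yᵢ) ≤ γ` for `i = 0 … k`, i.e. `x ∈ ⋂ᵢ A_{yᵢ}` (and `K_γ ≠ ∅`). Compactness of
`K_γ` then gives `x̄ ∈ ⋂_y A_y`. ∎ (Values form, for the card: `inf_X sup_Y φ = sup_Y inf_X φ`, the `inf`
attained when finite.) Leans on: S2 (the hypothesis), Mathlib `stdSimplex` (`isCompact_stdSimplex`,
`convex_stdSimplex`), `Finset.sum` algebra on `Fin (k+1) → ℝ`, `LowerSemicontinuous.isClosed_preimage`,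
`IsCompact.inter_iInter_nonempty`. [Aubin, Optima and Equilibria, GTM 140 (1993), Thm 8.1, Prop. 8.2–8.3,
Exercise 8.1 (lower semi-compactness replaces compactness); Aubin–Ekeland, Applied Nonlinear Analysis (1984),
Ch. 6 §2 Thm 7 (lopsided minimax).] -/
theorem stub_lopsided_of_fan :
    (∀ (X Y : Type) [TopologicalSpace X] [CompactSpace X] [Nonempty Y] (φ : X → Y → ℝ),
      (∀ y : Y, LowerSemicontinuous fun x : X => φ x y) →
      (∀ (x₁ x₂ : X) (t : ℝ), 0 ≤ t → t ≤ 1 → ∃ x₀ : X, ∀ y : Y, φ x₀ y ≤ t * φ x₁ y + (1 - t) * φ x₂ y) →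
      (∀ (y₁ y₂ : Y) (t : ℝ), 0 ≤ t → t ≤ 1 → ∃ y₀ : Y, ∀ x : X, t * φ x y₁ + (1 - t) * φ x y₂ ≤ φ x y₀) →
      ∀ γ : ℝ, (∀ x : X, ∃ y : Y, γ < φ x y) → ∃ y : Y, ∀ x : X, γ < φ x y) →
    ∀ (X Y : Type) [TopologicalSpace X] [Nonempty Y] (φ : X → Y → ℝ),
      (∀ y : Y, LowerSemicontinuous fun x : X => φ x y) →
      (∀ (x₁ x₂ : X) (t : ℝ), 0 ≤ t → t ≤ 1 → ∃ x₀ : X, ∀ y : Y, φ x₀ y ≤ t * φ x₁ y + (1 - t) * φ x₂ y) →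
      (∀ (y₁ y₂ : Y) (t : ℝ), 0 ≤ t → t ≤ 1 → ∃ y₀ : Y, ∀ x : X, t * φ x y₁ + (1 - t) * φ x y₂ ≤ φ x y₀) →
      (∃ y₀ : Y, ∀ c : ℝ, IsCompact {x : X | φ x y₀ ≤ c}) →
      ∀ γ : ℝ, (∀ x : X, ∃ y : Y, γ < φ x y) → ∃ y : Y, ∀ x : X, γ < φ x y := by
  sorry

/-- **S4 `stub_floorMinimax`** — size L, provable now GIVEN its four hypotheses (S0, the conclusion of S1,
the lopsided principle = conclusion of S3, S3a): STRONG DUALITY FOR FLOORS ON A BALL, the instantiation of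
the lopsided minimax (hardest provable-now stub; all measure-theoretic plumbing of the line lives here). For
`ν > 0`, ANY radius² `ρ`, level `ε` and smooth `f`: if every relaxed stationary statistic of `NS_ν(f)` on
`{|u|² ≤ ρ}` — probability measure on `H` carried by the ball, finite mean enstrophy, annihilating every
cylindrical Liouville functional, integrable work, ONE global mean energy inequality — has mean dissipation
`≥ ε`, then for every margin `δ > 0` some cylindrical `Φ` and weight `θ ≤ 0` certify the floor `ε − δ` at every
finite-enstrophy state of the ball. (At `ρ = 16‖f‖²/ν²` the hypothesis block is VERBATIM S5's and the
conclusion is `Negative.FloorFamily f (ε − δ) ν`, see `floorFamily_iff_certifiesFloor`.) WHY TRUE: fix `ν > 0`,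
`ρ`, `ε`, `f`, `δ > 0`; if `ρ < 0` every `(Φ, 0)` certifies vacuously, so let `ρ ≥ 0`. GAME:
`X := {μ : ProbabilityMeasure H // μ-a.e. |u|² ≤ ρ ∧ ∫⁻‖∇u‖²dμ < ∞}` (subspace topology; the universe
sanity checks below confirm that `X` and `Y` live in `Type`, as S3 requires),
`Y := {(Φ, θ) : θ ≤ 0}` (nonempty), `φ(μ, (Φ,θ)) := ∫ L_{Φ,θ} dμ =
(1 − 2θ)·ν(∫⁻‖∇u‖²dμ).toReal + ∫⟨F_ν,Φ'⟩dμ + 2θ∫(u,f)dμ` (all integrands integrable on `X`: the generator term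
and the work are continuous on `H` — `Torus.continuous_nsGeneratorPairing_grad`, `Torus.continuous_pairing_coe` —
and bounded on the ball — `Torus.exists_abs_nsGeneratorPairing_grad_le` gives `|⟨F,Φ'⟩| ≤ K(1+ρ)`,
`|(u,f)| ≤ √ρ‖f‖` by `Torus.abs_pairing_coe_le`). HYPOTHESES OF S3: (lsc) the enstrophy term is lsc in `μ`
by S0 (restrict to the subtype; `1 − 2θ ≥ 1 > 0`; `toReal` is monotone and continuous on the finite values
taken on `X`), the two other terms are CONTINUOUS on `X` (replace each integrand `g` by the bounded continuous
`u ↦ g(r(u))`, `r(u) = min(1, √ρ/|u|)•u` the radial retraction onto the ball — equal to `g` on the ball, hence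
`μ`-a.e. for every `μ ∈ X` — and use `ProbabilityMeasure.tendsto_iff_forall_integral_tendsto` /
`ProbabilityMeasure.continuous_integral_boundedContinuousFunction`); (convex-like in `μ`) mix,
`μ₀ = tμ₁ + (1−t)μ₂ ∈ X`, `φ` is affine in `μ` (equality); (concave-like in `y`) `θ₀ = tθ₁ + (1−t)θ₂ ≤ 0` and
`Φ₀` from S3a with `(a,b) = (t, 1−t)`: by `Torus.nsGeneratorPairing_sum_smul` the Lagrangians agree ON THE
BALL, `L_{y₀} = tL_{y₁} + (1−t)L_{y₂}`, hence `φ(μ,y₀) = tφ(μ,y₁) + (1−t)φ(μ,y₂)` for `μ ∈ X` (carried by the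
ball); (inf-compact at `y₀ = (Φ_zero, 0)`, `Φ_zero` from S3a with `a = b = 0`, generator term `0` by
`Torus.nsGeneratorPairing_sum_smul` with zero coefficients) `{μ ∈ X : φ(μ,y₀) ≤ c}` is the S1-set at level
`ENNReal.ofReal (c/ν)` (empty for `c < 0`), compact in `ProbabilityMeasure H` and contained in `X`, hence
compact in `X` (`Topology.IsInducing.isCompact_iff` for `Subtype.val`). LEVEL: `γ := ε − δ`; every `μ ∈ X` is
beaten above `γ`: if `μ` is relaxed stationary, `φ(μ, y₀) = ν∫‖∇u‖²dμ ≥ ε > γ` by the hypothesis; if some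
Liouville integral `∫⟨F,Φ'⟩dμ = c ≠ 0`, the scaled functional `Φ_s` (S3a, `(a,b) = (s,0)`) gives
`φ(μ,(Φ_s,0)) = ν∫‖∇u‖²dμ + s c → +∞`; if the energy inequality fails, `∫(u,f)dμ − ν∫‖∇u‖²dμ = −d < 0`, then
`φ(μ,(Φ_zero,θ)) = ν∫‖∇u‖²dμ + 2|θ|d → +∞` as `θ → −∞` (these exhaust the failure of the relaxed block on `X`:
probability, ball, finite enstrophy and the two integrabilities hold automatically there). CONCLUSION of S3:
ONE `y = (Φ, θ)`, `θ ≤ 0`, with `φ(μ, y) > γ` for all `μ ∈ X`; evaluate at DIRAC masses `δ_u`, `u` a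
finite-enstrophy state of the ball (`δ_u ∈ X`: `ae_dirac_iff` with the closed — hence measurable — ball,
`lintegral_dirac'` with `Torus.measurable_eGradNormSq_coe`; `integral_dirac` for the continuous integrands):
`L_{Φ,θ}(u) = φ(δ_u, y) > ε − δ`. ∎ Degenerate instances (triage r1-3, re-checked): `ρ < 0` vacuous; `ρ = 0`,
`f ≠ 0` — `X = {δ₀}`, not Liouville, so arbitrarily high floors are certified at rest by `Φ_s`; `f = 0` — `δ₀`
is relaxed with zero dissipation, so the hypothesis forces `ε ≤ 0`. Finite-dimensional shadow (sanity): on a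
Galerkin truncation the statement is Tobasco–Goluskin–Doering's theorem (tree
`TobascoGoluskinDoering2018_measureForm`). Leans on: S0, S1, S3, S3a; `CylindricalGenerator`
(`continuous_nsGeneratorPairing_grad`, `exists_abs_nsGeneratorPairing_grad_le`, `nsGeneratorPairing_sum_smul`),
`StatisticalSolutionEnergyEq` (`continuous_pairing_coe`, `abs_pairing_coe_le`), `EnergySpaceRellich`
(`lowerSemicontinuous_eGradNormSq_coe`), `Torus.measurable_eGradNormSq_coe`, Mathlib `ProbabilityMeasure`
(weak topology, `tendsto_iff_forall_integral_tendsto`), `Measure.dirac`. [arXiv:2010.06730 Thm 4.1, Thm 6.2,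
Rem 6.1–6.2 (Rosa–Temam: strong duality only on H-compact K in 3-D — here compactness is supplied by the
objective); arXiv:1705.07096 (Tobasco–Goluskin–Doering, compact phase space); FoiasManleyRosaTemam2001 IV §1.] -/
theorem stub_floorMinimax :
    (LowerSemicontinuous fun μ : ProbabilityMeasure (Torus.energySpace (Fin 3)) =>
      Torus.ensembleEnstrophy (μ : Measure (Torus.energySpace (Fin 3)))) →
    (∀ (ρ : ℝ) (c : ℝ≥0∞), c ≠ ⊤ →
      IsCompact {μ : ProbabilityMeasure (Torus.energySpace (Fin 3)) |
        (∀ᵐ u ∂(μ : Measure (Torus.energySpace (Fin 3))), ‖u‖ ^ 2 ≤ ρ) ∧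
          Torus.ensembleEnstrophy (μ : Measure (Torus.energySpace (Fin 3))) ≤ c}) →
    (∀ (X Y : Type) [TopologicalSpace X] [Nonempty Y] (φ : X → Y → ℝ),
      (∀ y : Y, LowerSemicontinuous fun x : X => φ x y) →
      (∀ (x₁ x₂ : X) (t : ℝ), 0 ≤ t → t ≤ 1 → ∃ x₀ : X, ∀ y : Y, φ x₀ y ≤ t * φ x₁ y + (1 - t) * φ x₂ y) →
      (∀ (y₁ y₂ : Y) (t : ℝ), 0 ≤ t → t ≤ 1 → ∃ y₀ : Y, ∀ x : X, t * φ x y₁ + (1 - t) * φ x y₂ ≤ φ x y₀) →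
      (∃ y₀ : Y, ∀ c : ℝ, IsCompact {x : X | φ x y₀ ≤ c}) →
      ∀ γ : ℝ, (∀ x : X, ∃ y : Y, γ < φ x y) → ∃ y : Y, ∀ x : X, γ < φ x y) →
    (∀ (ρ a b : ℝ) (Φ₁ Φ₂ : Torus.CylindricalTest (Fin 3)), ∃ Φ₀ : Torus.CylindricalTest (Fin 3),
      ∀ u : Torus.energySpace (Fin 3), ‖u‖ ^ 2 ≤ ρ → Φ₀.grad u = a • Φ₁.grad u + b • Φ₂.grad u) →
    ∀ (ν ρ ε : ℝ) (f : UnitAddTorus (Fin 3) → EuclideanSpace ℝ (Fin 3)), 0 < ν → Torus.IsSmooth f →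
      (∀ μ : Measure (Torus.energySpace (Fin 3)),
          IsProbabilityMeasure μ →
          (∀ᵐ u ∂μ, ‖u‖ ^ 2 ≤ ρ) →
          Torus.ensembleEnstrophy μ < ⊤ →
          (∀ Φ : Torus.CylindricalTest (Fin 3),
            Integrable (fun u => Torus.nsGeneratorPairing ν f u (Φ.grad u)) μ ∧
              ∫ u, Torus.nsGeneratorPairing ν f u (Φ.grad u) ∂μ = 0) →
          Integrable (fun u : Torus.energySpace (Fin 3) => Torus.pairing u.1 f) μ →
          Torus.ensembleDissipation ν μ ≤ ∫ u, Torus.pairing u.1 f ∂μ →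
          ε ≤ Torus.ensembleDissipation ν μ) →
      ∀ δ : ℝ, 0 < δ →
        ∃ (Φ : Torus.CylindricalTest (Fin 3)) (θ : ℝ), θ ≤ 0 ∧
          ∀ u : Torus.energySpace (Fin 3),
            Torus.eGradNormSq (u.1 : UnitAddTorus (Fin 3) → EuclideanSpace ℝ (Fin 3)) ≠ ⊤ →
            ‖u‖ ^ 2 ≤ ρ →
              ε - δ ≤ ν * (Torus.eGradNormSq (u.1 : UnitAddTorus (Fin 3) → EuclideanSpace ℝ (Fin 3))).toReal +
                Torus.nsGeneratorPairing ν f u (Φ.grad u) +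
                2 * θ * (Torus.pairing u.1 f -
                  ν * (Torus.eGradNormSq (u.1 : UnitAddTorus (Fin 3) → EuclideanSpace ℝ (Fin 3))).toReal) := by
  sorry

/-- **S5 `stub_relaxedEnsembleFloor`** (VERBATIM the sibling line's S5 — prove/refute once) — OPEN (the bet;
HARDEST; the crux's entire physical content in dual form). THE TRANSFER TARGET `C⁺`: some smooth solenoidal
mean-zero force has a UNIFORM RELAXED-ENSEMBLE FLOOR — `ε₀, ν₀ > 0` such that for `ν ∈ (0, ν₀)` every relaxed
stationary statistic of `NS_ν(f)` on the Leray ball (probability measure on `H` carried by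
`{|u|² ≤ 16‖f‖²/ν²}`, finite mean enstrophy, annihilating every cylindrical Liouville functional, `u ↦ (u,f)`
integrable, the ONE global mean energy inequality `ν∫‖∇u‖²dμ ≤ ∫(u,f)dμ`) dissipates at least `ε₀`: NO QUIET
RELAXED STATIONARY STATISTICS (no quiet steady state, periodic orbit, invariant measure, generalized time
average, or non-dynamical relaxed measure) as `ν → 0`. NECESSARY for the crux
(`relaxedEnsembleFloor_of_floorCertificate`, PROVED below), equivalent to it given S0–S4. WHY IT MIGHT FAIL: for
every smooth `f` there may be quiet invariant objects — a quiet steady branch (viscous continuation of a forced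
steady Euler state `P[(v·∇)v] = f`, bounded energy; route crux `SmoothEulerCoerciveForce` is the pointwise
obstruction, cards `cokernel-drift-escape` K3 / `newton-decrement-collars` the continuation tests), WARM
self-sustained sheltered shears (`|u|² ≍ ν^{-2/3}`, `D ≍ ν^{1/3}`; card `shear-sheltering-dichotomy`, its toys
j009329/j009988 came back unsupportive; void on single lines for the gravest Kolmogorov force by
Iudovich–Marchioro, TRIAGE-r1-3 (X2)), or a LEAKY quiet relaxed-but-not-FMRT measure (the relaxed class carries
ONE global energy inequality; see the PROVED split `uniformRelaxedFloor_of_inputFloor_of_leakLittle` below for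
the exact shape of that risk). WHY IT MIGHT HOLD / WHAT THE DUAL FORM BUYS (card, Transfer (a)–(c)): the enemy is
an EXACT object — finitely supported relaxed statistics are convex combinations of Diracs at exact
finite-enstrophy steady states (localise `φ` around one atom), so the steady half IS crux #3's floor clause; the
class is convex, narrowly closed at fixed `ν`, invariant under the isometry group of `(T³, f)` and admits
Choquet/ergodic decomposition; every cylindrical `Φ` is an exact linear constraint (first-shell budget, work
identity `‖f‖² + ∫I_f dμ = νλ∫(u,f)dμ` for eigenfield forcing — `Lines/marchioro-force-floor.lean` S2), and a
proof for a designed `f` is a finite combination of such identities plus positivity — which, read back through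
S4, IS the certificate. First cuts on record (PROVED glue below, deliberately NOT stubs — neither half is
provable now): regime split bounded-energy / fat (`uniformRelaxedFloor_of_split`, as in the sibling skeleton)
and INPUT floor ∧ quiet-statistics-leak-little (`uniformRelaxedFloor_of_inputFloor_of_leakLittle`). FORCE
CANDIDATES on record (tenure's call; the stub keeps `∃ f`): the gravest Kolmogorov force `sin(2πx₁)e₀`
(sibling line `marchioro-force-floor`: every 2½-D sector laminar-loud; closes the ITEM, not the route's X), the
circularly polarised `E₁⁺` force `(sin 2πx₃, cos 2πx₃, 0)` (this card's planner note), or the route's genuinely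
3-D multi-shell force. Barriers: AlexakisDoering2006 bites only 2-D/2½-D statistics at BOUNDED `U`;
Marchioro1986 is an ALLY of a floor; Buckmaster–Vicol / Choffrut–Székelyhidi phantoms have infinite enstrophy
(outside the class). Cheapest falsifier: one quiet invariant object of the chosen `f` found numerically
(lower-branch continuation in fixed-force units) kills S5 FOR THAT `f` through `weak_duality` alone. Sources:
FoiasManleyRosaTemam2001 IV–V; DoeringFoias2002; arXiv:2010.06730; BrueDeLellis2023 Q 2.1–2.2;
arXiv:1512.02570; Disproof.lean §C (`QuietStatistics` is exactly `¬` this for every force). -/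
theorem stub_relaxedEnsembleFloor :
    ∃ f : UnitAddTorus (Fin 3) → EuclideanSpace ℝ (Fin 3),
      Torus.IsSmooth f ∧ Torus.IsDivFree f ∧ Torus.HasZeroMean f ∧
      ∃ ε₀ ν₀ : ℝ, 0 < ε₀ ∧ 0 < ν₀ ∧ ∀ ν : ℝ, 0 < ν → ν < ν₀ →
        ∀ μ : Measure (Torus.energySpace (Fin 3)),
          IsProbabilityMeasure μ →
          (∀ᵐ u ∂μ, ‖u‖ ^ 2 ≤ 16 * (∫ x, ‖f x‖ ^ 2) / ν ^ 2) →
          Torus.ensembleEnstrophy μ < ⊤ →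
          (∀ Φ : Torus.CylindricalTest (Fin 3),
            Integrable (fun u => Torus.nsGeneratorPairing ν f u (Φ.grad u)) μ ∧
              ∫ u, Torus.nsGeneratorPairing ν f u (Φ.grad u) ∂μ = 0) →
          Integrable (fun u : Torus.energySpace (Fin 3) => Torus.pairing u.1 f) μ →
          Torus.ensembleDissipation ν μ ≤ ∫ u, Torus.pairing u.1 f ∂μ →
          ε₀ ≤ Torus.ensembleDissipation ν μ := by
  sorry

/-! ## Universe sanity for S3/S4 (the instantiation types live in `Type`, as the abstract principles require) -/

example : Type := {μ : ProbabilityMeasure (Torus.energySpace (Fin 3)) //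
  (∀ᵐ u ∂(μ : Measure (Torus.energySpace (Fin 3))), ‖u‖ ^ 2 ≤ (1 : ℝ)) ∧
    Torus.ensembleEnstrophy (μ : Measure (Torus.energySpace (Fin 3))) < ⊤}

example : Type := {y : Torus.CylindricalTest (Fin 3) × ℝ // y.2 ≤ 0}

example : TopologicalSpace {μ : ProbabilityMeasure (Torus.energySpace (Fin 3)) //
  (∀ᵐ u ∂(μ : Measure (Torus.energySpace (Fin 3))), ‖u‖ ^ 2 ≤ (1 : ℝ)) ∧
    Torus.ensembleEnstrophy (μ : Measure (Torus.energySpace (Fin 3))) < ⊤} := inferInstance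

/-! ## Vocabulary (definitional abbreviations of the stub statements and of the crux's own terms) -/

/-- Squared Leray radius `16‖f‖²/ν²` (verbatim the crux's ball). -/
def lerayRadiusSq (f : Vec3) (ν : ℝ) : ℝ := 16 * (∫ x, ‖f x‖ ^ 2) / ν ^ 2

/-- `(Φ, θ)` CERTIFIES THE FLOOR `ε` at viscosity `ν` on the ball `{|u|² ≤ ρ}`: `θ ≤ 0` and the floor inequality
(verbatim the crux's right-hand side) holds at every finite-enstrophy state of the ball — the conclusion block of
S4; at `ρ = 16‖f‖²/ν²` it is `Negative.FloorFamily`, see `floorFamily_iff_certifiesFloor`. -/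
def CertifiesFloor (ν ρ ε : ℝ) (f : Vec3) (Φ : Torus.CylindricalTest (Fin 3)) (θ : ℝ) : Prop :=
  θ ≤ 0 ∧ ∀ u : H3, Torus.eGradNormSq (u.1 : Vec3) ≠ ⊤ → ‖u‖ ^ 2 ≤ ρ →
    ε ≤ ν * (Torus.eGradNormSq (u.1 : Vec3)).toReal + Torus.nsGeneratorPairing ν f u (Φ.grad u) +
      2 * θ * (Torus.pairing u.1 f - ν * (Torus.eGradNormSq (u.1 : Vec3)).toReal)

/-- The crux's floor family at `(f, ε, ν)` is a certificate on the Leray ball (definitional). -/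
theorem floorFamily_iff_certifiesFloor (f : Vec3) (ε ν : ℝ) :
    FloorFamily f ε ν ↔
      ∃ (Φ : Torus.CylindricalTest (Fin 3)) (θ : ℝ), CertifiesFloor ν (lerayRadiusSq f ν) ε f Φ θ :=
  Iff.rfl

/-- **RELAXED STATIONARY STATISTIC** of `NS_ν(f)` on the ball `{|u|² ≤ ρ}` — the EXACT dual object of the
crux's certificate class (the hypothesis block of S4, and of S5 at the Leray radius): a Borel probability measure
on `H` carried by the ball, of finite mean enstrophy, annihilating every cylindrical Liouville functional (dual
to the free multiplier `Φ`), with integrable work and the ONE global mean energy inequality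
`ν∫‖∇u‖²dμ ≤ ∫(u,f)dμ` (dual to `θ ≤ 0`). Strictly larger than FMRT's class at the Leray radius
(`isRelaxedSSS_of_isStationary`): no shell-wise inequalities (1.31). -/
structure IsRelaxedSSS (ν ρ : ℝ) (f : Vec3) (μ : Measure H3) : Prop where
  prob : IsProbabilityMeasure μ
  ae_ball : ∀ᵐ u ∂μ, ‖u‖ ^ 2 ≤ ρ
  enstrophy_finite : Torus.ensembleEnstrophy μ < ⊤
  liouville : ∀ Φ : Torus.CylindricalTest (Fin 3),
    Integrable (fun u => Torus.nsGeneratorPairing ν f u (Φ.grad u)) μ ∧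
      ∫ u, Torus.nsGeneratorPairing ν f u (Φ.grad u) ∂μ = 0
  work_integrable : Integrable (fun u : H3 => Torus.pairing u.1 f) μ
  energy_ineq : Torus.ensembleDissipation ν μ ≤ ∫ u, Torus.pairing u.1 f ∂μ

/-- S0 as a named statement. -/
def LscEnstrophy : Prop :=
  LowerSemicontinuous fun μ : ProbabilityMeasure (Torus.energySpace (Fin 3)) =>
    Torus.ensembleEnstrophy (μ : Measure (Torus.energySpace (Fin 3)))

/-- The conclusion of S1 as a named statement (S1 = `LscEnstrophy → DissipationSublevelCompact`). -/
def DissipationSublevelCompact : Prop :=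
  ∀ (ρ : ℝ) (c : ℝ≥0∞), c ≠ ⊤ →
    IsCompact {μ : ProbabilityMeasure (Torus.energySpace (Fin 3)) |
      (∀ᵐ u ∂(μ : Measure (Torus.energySpace (Fin 3))), ‖u‖ ^ 2 ≤ ρ) ∧
        Torus.ensembleEnstrophy (μ : Measure (Torus.energySpace (Fin 3))) ≤ c}

/-- S2 as a named statement: Ky Fan's convex-like minimax principle, `γ`-form. -/
def FanMinimax : Prop :=
  ∀ (X Y : Type) [TopologicalSpace X] [CompactSpace X] [Nonempty Y] (φ : X → Y → ℝ),
    (∀ y : Y, LowerSemicontinuous fun x : X => φ x y) →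
    (∀ (x₁ x₂ : X) (t : ℝ), 0 ≤ t → t ≤ 1 → ∃ x₀ : X, ∀ y : Y, φ x₀ y ≤ t * φ x₁ y + (1 - t) * φ x₂ y) →
    (∀ (y₁ y₂ : Y) (t : ℝ), 0 ≤ t → t ≤ 1 → ∃ y₀ : Y, ∀ x : X, t * φ x y₁ + (1 - t) * φ x y₂ ≤ φ x y₀) →
    ∀ γ : ℝ, (∀ x : X, ∃ y : Y, γ < φ x y) → ∃ y : Y, ∀ x : X, γ < φ x y

/-- The conclusion of S3 as a named statement: the LOPSIDED (inf-compact) minimax principle. -/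
def LopsidedMinimax : Prop :=
  ∀ (X Y : Type) [TopologicalSpace X] [Nonempty Y] (φ : X → Y → ℝ),
    (∀ y : Y, LowerSemicontinuous fun x : X => φ x y) →
    (∀ (x₁ x₂ : X) (t : ℝ), 0 ≤ t → t ≤ 1 → ∃ x₀ : X, ∀ y : Y, φ x₀ y ≤ t * φ x₁ y + (1 - t) * φ x₂ y) →
    (∀ (y₁ y₂ : Y) (t : ℝ), 0 ≤ t → t ≤ 1 → ∃ y₀ : Y, ∀ x : X, t * φ x y₁ + (1 - t) * φ x y₂ ≤ φ x y₀) →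
    (∃ y₀ : Y, ∀ c : ℝ, IsCompact {x : X | φ x y₀ ≤ c}) →
    ∀ γ : ℝ, (∀ x : X, ∃ y : Y, γ < φ x y) → ∃ y : Y, ∀ x : X, γ < φ x y

/-- S3a as a named statement: the cylindrical class is a vector space on every ball. -/
def CylindricalCombination : Prop :=
  ∀ (ρ a b : ℝ) (Φ₁ Φ₂ : Torus.CylindricalTest (Fin 3)), ∃ Φ₀ : Torus.CylindricalTest (Fin 3),
    ∀ u : Torus.energySpace (Fin 3), ‖u‖ ^ 2 ≤ ρ → Φ₀.grad u = a • Φ₁.grad u + b • Φ₂.grad u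

/-- The conclusion of S4 as a named statement: STRONG DUALITY FOR FLOORS ON A BALL (every radius). -/
def FloorMinimax : Prop :=
  ∀ (ν ρ ε : ℝ) (f : UnitAddTorus (Fin 3) → EuclideanSpace ℝ (Fin 3)), 0 < ν → Torus.IsSmooth f →
    (∀ μ : Measure (Torus.energySpace (Fin 3)),
        IsProbabilityMeasure μ →
        (∀ᵐ u ∂μ, ‖u‖ ^ 2 ≤ ρ) →
        Torus.ensembleEnstrophy μ < ⊤ →
        (∀ Φ : Torus.CylindricalTest (Fin 3),
          Integrable (fun u => Torus.nsGeneratorPairing ν f u (Φ.grad u)) μ ∧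
            ∫ u, Torus.nsGeneratorPairing ν f u (Φ.grad u) ∂μ = 0) →
        Integrable (fun u : Torus.energySpace (Fin 3) => Torus.pairing u.1 f) μ →
        Torus.ensembleDissipation ν μ ≤ ∫ u, Torus.pairing u.1 f ∂μ →
        ε ≤ Torus.ensembleDissipation ν μ) →
    ∀ δ : ℝ, 0 < δ →
      ∃ (Φ : Torus.CylindricalTest (Fin 3)) (θ : ℝ), θ ≤ 0 ∧
        ∀ u : Torus.energySpace (Fin 3),
          Torus.eGradNormSq (u.1 : UnitAddTorus (Fin 3) → EuclideanSpace ℝ (Fin 3)) ≠ ⊤ →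
          ‖u‖ ^ 2 ≤ ρ →
            ε - δ ≤ ν * (Torus.eGradNormSq (u.1 : UnitAddTorus (Fin 3) → EuclideanSpace ℝ (Fin 3))).toReal +
              Torus.nsGeneratorPairing ν f u (Φ.grad u) +
              2 * θ * (Torus.pairing u.1 f -
                ν * (Torus.eGradNormSq (u.1 : UnitAddTorus (Fin 3) → EuclideanSpace ℝ (Fin 3))).toReal)

/-- The UNIFORM RELAXED-ENSEMBLE FLOOR of a force `f` (the dual form of the crux AT `f`): below `ν₀` every relaxed
stationary statistic of `NS_ν(f)` on the Leray ball dissipates at least `ε₀` in the mean —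
`liminf_{ν→0} ℓ_f(ν) > 0` for `ℓ_f(ν) = inf{ν∫‖∇u‖²dμ : μ relaxed stationary on the Leray ball}`. -/
def UniformRelaxedFloor (f : Vec3) : Prop :=
  ∃ ε₀ ν₀ : ℝ, 0 < ε₀ ∧ 0 < ν₀ ∧ ∀ ν : ℝ, 0 < ν → ν < ν₀ →
    ∀ μ : Measure H3, IsRelaxedSSS ν (lerayRadiusSq f ν) f μ → ε₀ ≤ Torus.ensembleDissipation ν μ

/-- S5 as a named statement — THE TRANSFER TARGET `C⁺` (OPEN): some smooth solenoidal mean-zero force has a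
uniform relaxed-ensemble floor (curried exactly as the stub; `relaxedEnsembleFloor_iff` is the bundled reading). -/
def RelaxedEnsembleFloor : Prop :=
  ∃ f : UnitAddTorus (Fin 3) → EuclideanSpace ℝ (Fin 3),
    Torus.IsSmooth f ∧ Torus.IsDivFree f ∧ Torus.HasZeroMean f ∧
    ∃ ε₀ ν₀ : ℝ, 0 < ε₀ ∧ 0 < ν₀ ∧ ∀ ν : ℝ, 0 < ν → ν < ν₀ →
      ∀ μ : Measure (Torus.energySpace (Fin 3)),
        IsProbabilityMeasure μ →
        (∀ᵐ u ∂μ, ‖u‖ ^ 2 ≤ 16 * (∫ x, ‖f x‖ ^ 2) / ν ^ 2) →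
        Torus.ensembleEnstrophy μ < ⊤ →
        (∀ Φ : Torus.CylindricalTest (Fin 3),
          Integrable (fun u => Torus.nsGeneratorPairing ν f u (Φ.grad u)) μ ∧
            ∫ u, Torus.nsGeneratorPairing ν f u (Φ.grad u) ∂μ = 0) →
        Integrable (fun u : Torus.energySpace (Fin 3) => Torus.pairing u.1 f) μ →
        Torus.ensembleDissipation ν μ ≤ ∫ u, Torus.pairing u.1 f ∂μ →
        ε₀ ≤ Torus.ensembleDissipation ν μ

/-- Bundled reading of `C⁺`: some admissible force has a uniform relaxed floor (currying the conjunction). -/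
theorem relaxedEnsembleFloor_iff :
    RelaxedEnsembleFloor ↔
      ∃ f : Vec3, Torus.IsSmooth f ∧ Torus.IsDivFree f ∧ Torus.HasZeroMean f ∧ UniformRelaxedFloor f := by
  constructor
  · rintro ⟨f, hfs, hfd, hfz, ε₀, ν₀, hε₀, hν₀, h⟩
    exact ⟨f, hfs, hfd, hfz, ε₀, ν₀, hε₀, hν₀, fun ν hν hνlt μ hμ =>
      h ν hν hνlt μ hμ.prob hμ.ae_ball hμ.enstrophy_finite hμ.liouville hμ.work_integrable hμ.energy_ineq⟩
  · rintro ⟨f, hfs, hfd, hfz, ε₀, ν₀, hε₀, hν₀, h⟩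
    exact ⟨f, hfs, hfd, hfz, ε₀, ν₀, hε₀, hν₀, fun ν hν hνlt μ h1 h2 h3 h4 h5 h6 =>
      h ν hν hνlt μ ⟨h1, h2, h3, h4, h5, h6⟩⟩

/-- Bundled reading of `FloorMinimax`: if every `IsRelaxedSSS ν ρ f μ` dissipates `≥ ε`, then for every
`δ > 0` some `(Φ, θ)` `CertifiesFloor ν ρ (ε − δ) f Φ θ`. -/
theorem floorMinimax_bundled (h : FloorMinimax) {ν ρ ε : ℝ} {f : Vec3} (hν : 0 < ν) (hf : Torus.IsSmooth f)
    (hfloor : ∀ μ : Measure H3, IsRelaxedSSS ν ρ f μ → ε ≤ Torus.ensembleDissipation ν μ) {δ : ℝ}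
    (hδ : 0 < δ) : ∃ (Φ : Torus.CylindricalTest (Fin 3)) (θ : ℝ), CertifiesFloor ν ρ (ε - δ) f Φ θ :=
  h ν ρ ε f hν hf (fun μ h1 h2 h3 h4 h5 h6 => hfloor μ ⟨h1, h2, h3, h4, h5, h6⟩) δ hδ

/-! ## The composition: `FloorCertificate` from S0–S5 (kernel-checked; no `sorry` of its own) -/

/-- **`FloorCertificate` from the seven stub statements.** Feed S0 to S1 (compact dissipation sublevel sets),
S2 to S3 (lopsided minimax), and S0, S1, S3, S3a to S4 (`FloorMinimax`); take the force `f` and `(ε₀, ν₀)` of S5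
and answer the crux with `(f, ε₀/2, ν₀)`: at `ν ∈ (0, ν₀)` every relaxed stationary statistic on the Leray ball
dissipates `≥ ε₀` (S5), so `FloorMinimax` at `ρ = 16‖f‖²/ν²` with margin `δ = ε₀/2` hands over `(Φ, θ ≤ 0)`
certifying `ε₀ − ε₀/2 = ε₀/2` at every finite-enstrophy state of the Leray ball — verbatim the crux's floor
family. -/
theorem FloorCertificate_of :
    LscEnstrophy → (LscEnstrophy → DissipationSublevelCompact) → FanMinimax → CylindricalCombination →
      (FanMinimax → LopsidedMinimax) →
        (LscEnstrophy → DissipationSublevelCompact → LopsidedMinimax → CylindricalCombination → FloorMinimax) →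
          RelaxedEnsembleFloor → FloorCertificate := by
  intro h0 h1 h2 h3a h3 h4 h5
  have hFM : FloorMinimax := h4 h0 (h1 h0) (h3 h2) h3a
  obtain ⟨f, hfs, hfd, hfz, ε₀, ν₀, hε₀, hν₀, hC⟩ := h5
  rw [floorCertificate_iff]
  refine ⟨f, hfs, hfd, hfz, ε₀ / 2, ν₀, half_pos hε₀, hν₀, fun ν hν hνlt => ?_⟩
  obtain ⟨Φ, θ, hθ, hfloor⟩ :=
    hFM ν (16 * (∫ x, ‖f x‖ ^ 2) / ν ^ 2) ε₀ f hν hfs (hC ν hν hνlt) (ε₀ / 2) (half_pos hε₀)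
  refine ⟨Φ, θ, hθ, fun u => ?_⟩
  intro hfin hball
  have h := hfloor u hfin hball
  have e : ε₀ - ε₀ / 2 = ε₀ / 2 := by ring
  rw [e] at h
  exact h

/-- The same composition wired to the sorried stubs: a closed term of the crux's type modulo S0–S5 — and the
kernel's check that every EXPANDED stub signature is definitionally the named statement it is meant to be. -/
theorem FloorCertificate_of_stubs : FloorCertificate :=
  FloorCertificate_of stub_lscEnstrophy stub_sublevelCompact stub_fanMinimax stub_cylindricalCombination
    stub_lopsided_of_fan stub_floorMinimax stub_relaxedEnsembleFloor

/-! ## Proved: weak duality at every radius, exactness, FMRT ⊂ relaxed, what S5 buys -/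

/-- **WEAK DUALITY for the relaxed class at every radius (PROVED).** A certificate `(Φ, θ)` for the floor `ε`
on the ball `{|u|² ≤ ρ}` bounds the mean dissipation of EVERY relaxed stationary statistic of `NS_ν(f)` on that
ball from below: the floor holds `μ`-a.e. (finite enstrophy a.e., carried by the ball), integrate, the Liouville
identity kills the generator term, `θ ≤ 0` and the global energy inequality sign the energy channel away. (The
every-radius relaxed-class form of the landed `Negative.floorFamily_le_ensembleDissipation`; the easy direction
of the minimax.) -/
theorem weak_duality {ν ρ ε : ℝ} {f : Vec3} {Φ : Torus.CylindricalTest (Fin 3)} {θ : ℝ}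
    (hcert : CertifiesFloor ν ρ ε f Φ θ) {μ : Measure H3} (hμ : IsRelaxedSSS ν ρ f μ) :
    ε ≤ Torus.ensembleDissipation ν μ := by
  obtain ⟨hθ, hfloor⟩ := hcert
  haveI := hμ.prob
  set G : H3 → ℝ≥0∞ := fun u => Torus.eGradNormSq ((u : L2) : Vec3) with hG
  have hGm : Measurable G := Torus.measurable_eGradNormSq_coe
  have hGfin : ∫⁻ u, G u ∂μ < ∞ := hμ.enstrophy_finite
  have hGlt : ∀ᵐ u ∂μ, G u < ∞ := ae_lt_top hGm hGfin.ne
  have hA : Integrable (fun u => (G u).toReal) μ :=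
    integrable_toReal_of_lintegral_ne_top hGm.aemeasurable hGfin.ne
  have hB : Integrable (fun u : H3 => Torus.pairing (u : L2) f) μ := hμ.work_integrable
  obtain ⟨hC, hC0⟩ := hμ.liouville Φ
  -- the FLOOR holds `μ`-a.e.
  have hae : ∀ᵐ u ∂μ, ε ≤ ν * (G u).toReal + Torus.nsGeneratorPairing ν f u (Φ.grad u) +
      2 * θ * (Torus.pairing (u : L2) f - ν * (G u).toReal) := by
    filter_upwards [hGlt, hμ.ae_ball] with u hu hball
    exact hfloor u hu.ne hball
  -- integrate
  have h1 : Integrable (fun u : H3 => ν * (G u).toReal) μ := hA.const_mul ν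
  have h2 : Integrable (fun u : H3 => ν * (G u).toReal + Torus.nsGeneratorPairing ν f u (Φ.grad u)) μ :=
    h1.add hC
  have h3 : Integrable (fun u : H3 => Torus.pairing (u : L2) f - ν * (G u).toReal) μ := hB.sub h1
  have h4 : Integrable (fun u : H3 => 2 * θ * (Torus.pairing (u : L2) f - ν * (G u).toReal)) μ :=
    h3.const_mul _
  have hint : Integrable (fun u : H3 => ν * (G u).toReal + Torus.nsGeneratorPairing ν f u (Φ.grad u) +
      2 * θ * (Torus.pairing (u : L2) f - ν * (G u).toReal)) μ := h2.add h4
  have hmono := integral_mono_ae (integrable_const ε) hint hae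
  have hconst : ∫ _ : H3, ε ∂μ = ε := by simp
  have hsplit : ∫ u : H3, (ν * (G u).toReal + Torus.nsGeneratorPairing ν f u (Φ.grad u) +
      2 * θ * (Torus.pairing (u : L2) f - ν * (G u).toReal)) ∂μ =
      ν * (∫⁻ u, G u ∂μ).toReal + 0 +
        2 * θ * (∫ u : H3, Torus.pairing (u : L2) f ∂μ - ν * (∫⁻ u, G u ∂μ).toReal) := by
    rw [integral_add h2 h4, integral_add h1 hC, integral_const_mul, integral_const_mul, integral_sub hB h1,
      integral_const_mul, hC0, integral_toReal hGm.aemeasurable hGlt]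
  rw [hconst, hsplit] at hmono
  -- the global energy inequality `ν ∫‖∇u‖² ≤ ∫ (u,f)`
  have hE : ν * (∫⁻ u, G u ∂μ).toReal ≤ ∫ u, Torus.pairing (u : L2) f ∂μ := hμ.energy_ineq
  have hθ' : 2 * θ * (∫ u, Torus.pairing (u : L2) f ∂μ - ν * (∫⁻ u, G u ∂μ).toReal) ≤ 0 :=
    mul_nonpos_of_nonpos_of_nonneg (by linarith) (by linarith)
  change ε ≤ ν * (∫⁻ u, G u ∂μ).toReal
  linarith

/-- **EXACTNESS (PROVED): the crux implies S5.** `FloorCertificate → RelaxedEnsembleFloor` by weak duality on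
the Leray balls — so S5 is NECESSARY for the crux, and with S0–S4 equivalent to it: the transfer passes through
the strong-duality theorem (S0–S4, the layer-2 item the route header lists under NOT DECOMPOSED YET), not
through rewording. -/
theorem relaxedEnsembleFloor_of_floorCertificate (h : FloorCertificate) : RelaxedEnsembleFloor := by
  rw [floorCertificate_iff] at h
  obtain ⟨f, hfs, hfd, hfz, ε₀, ν₀, hε₀, hν₀, hcert⟩ := h
  rw [relaxedEnsembleFloor_iff]
  refine ⟨f, hfs, hfd, hfz, ε₀, ν₀, hε₀, hν₀, fun ν hν hνlt μ hμ => ?_⟩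
  obtain ⟨Φ, θ, hΦ⟩ := (floorFamily_iff_certifiesFloor f ε₀ ν).1 (hcert ν hν hνlt)
  exact weak_duality hΦ hμ

/-- The crux and its dual form are ONE statement modulo the strong-duality theorem S0–S4 (both directions
kernel-checked; the analysis enters only `←`). -/
theorem floorCertificate_iff_relaxedEnsembleFloor (h0 : LscEnstrophy) (h1 : LscEnstrophy → DissipationSublevelCompact)
    (h2 : FanMinimax) (h3a : CylindricalCombination) (h3 : FanMinimax → LopsidedMinimax)
    (h4 : LscEnstrophy → DissipationSublevelCompact → LopsidedMinimax → CylindricalCombination → FloorMinimax) :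
    FloorCertificate ↔ RelaxedEnsembleFloor :=
  ⟨relaxedEnsembleFloor_of_floorCertificate, FloorCertificate_of h0 h1 h2 h3a h3 h4⟩

/-- **FMRT ⊂ RELAXED (PROVED).** Every stationary statistical solution of `NS_ν(f)` (FMRT IV Def. 1.3, `ν > 0`,
`f` smooth) is a relaxed stationary statistic on the Leray ball: support bound (1.34) `|u| ≤ ‖f‖/(4π²ν)` ⊂ Leray
ball (`ae_norm_le`, `Negative.ball_of_norm_le`), finite mean enstrophy (1.29), the Liouville equation (1.30), and
the shell inequality (1.31) at `(0, ∞)` (`energy_le_holds`). Hence Dirac masses at steady states in `V` and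
generalized time-average measures of Leray–Hopf flows are relaxed statistics (tree
`isStationaryStatisticalSolution_dirac_holds`, `timeAverage_isStationary_holds`). -/
theorem isRelaxedSSS_of_isStationary {ν : ℝ} (hν : 0 < ν) {f : Vec3} (hfs : Torus.IsSmooth f)
    {μ : Measure H3} (hμ : Torus.IsStationaryStatisticalSolution ν f μ) :
    IsRelaxedSSS ν (lerayRadiusSq f ν) f μ := by
  have hf : MemLp f 2 volume := hfs.memLp 2
  refine ⟨hμ.prob, ?_, hμ.enstrophy_finite, hμ.generator, hμ.integrable_pairing hf, ?_⟩
  · filter_upwards [hμ.ae_norm_le hν hf] with u hu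
    exact ball_of_norm_le hν hf hu
  · exact Torus.IsStationaryStatisticalSolution.energy_le_holds hμ hf

/-- **What S5 buys physically (PROVED): the ensemble zeroth-law floor over FMRT statistics.** Under a uniform
relaxed floor every stationary statistical solution of `NS_ν(f)`, `ν < ν₀`, dissipates at least `ε₀` — the "dual
reading" in the crux's docstring, and the exact negation lane of the disprover's `QuietStatistics` (Disproof.lean
§C) for the witness force. -/
theorem fmrt_loud_of_uniformRelaxedFloor {f : Vec3} (hfs : Torus.IsSmooth f) (h : UniformRelaxedFloor f) :
    ∃ ε₀ ν₀ : ℝ, 0 < ε₀ ∧ 0 < ν₀ ∧ ∀ ν : ℝ, 0 < ν → ν < ν₀ → ∀ μ : Measure H3,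
      Torus.IsStationaryStatisticalSolution ν f μ → ε₀ ≤ Torus.ensembleDissipation ν μ := by
  obtain ⟨ε₀, ν₀, hε₀, hν₀, h⟩ := h
  exact ⟨ε₀, ν₀, hε₀, hν₀, fun ν hν hνlt μ hμ => h ν hν hνlt μ (isRelaxedSSS_of_isStationary hν hfs hμ)⟩

/-- **Steady states are the Dirac atoms of the dual class (PROVED corollary of weak duality):** under a
certificate on the ball `ρ`, every relaxed statistic — in particular the Dirac mass at an exact finite-enstrophy
steady state of the ball, when it is relaxed — dissipates `≥ ε`; this is the every-radius home of the landed
`Negative.floorFamily_le_dissipation_of_steady`. Stated abstractly to avoid re-proving the Dirac bookkeeping. -/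
theorem dirac_loud_of_certifiesFloor {ν ρ ε : ℝ} {f : Vec3} {Φ : Torus.CylindricalTest (Fin 3)} {θ : ℝ}
    (hcert : CertifiesFloor ν ρ ε f Φ θ) {u : H3} (hu : IsRelaxedSSS ν ρ f (Measure.dirac u)) :
    ε ≤ Torus.ensembleDissipation ν (Measure.dirac u) :=
  weak_duality hcert hu

/-! ## Proved glue offered to the lead: two honest cuts of S5 (NOT stubs — neither half is provable now)

The certificate's energy channel `θ ≤ 0` cannot price a LEAK `∫(u,f)dμ − ν∫‖∇u‖²dμ > 0` (weak duality gives
`ε ≤ ε(μ) + 2θ·leak ≤ ε(μ)`), so S5 at `f` is exactly the conjunction of the physically believed INPUT floor and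
the regularity-flavoured statement that QUIET statistics leak little; independently, a quiet sequence splits by
mean energy into a bounded-energy (DODGER) regime and a fat (WARM) regime. Both cuts are recorded as proved glue;
the card's own clause (3) ("spent as a LINE if S5 cannot be cut into ≥ 2 genuine stubs") is answered honestly in
the line card: no cut makes either half provable, so S5 stays ONE stub and the provable content S0–S4 is what this
line contributes. -/

/-- INPUT FLOOR of `f`: every relaxed stationary statistic on the Leray ball injects at least `ε₀`,
`∫(u,f)dμ ≥ ε₀`, uniformly in `ν < ν₀`. -/
def RelaxedInputFloor (f : Vec3) : Prop :=
  ∃ ε₀ ν₀ : ℝ, 0 < ε₀ ∧ 0 < ν₀ ∧ ∀ ν : ℝ, 0 < ν → ν < ν₀ →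
    ∀ μ : Measure H3, IsRelaxedSSS ν (lerayRadiusSq f ν) f μ → ε₀ ≤ ∫ u, Torus.pairing u.1 f ∂μ

/-- QUIET STATISTICS LEAK LITTLE for `f`: for every tolerance `η > 0`, below some dissipation level `ε₂` and
viscosity `ν₂`, a relaxed stationary statistic with `ε(μ) < ε₂` has leak `∫(u,f)dμ − ε(μ) ≤ η` (stationary
ensemble shadow of the energy EQUALITY at positive viscosity; zero leak holds for every finitely supported
relaxed statistic by Temam's `IsSteadyWeakSolution.energy_eq'`). -/
def QuietStatisticsLeakLittle (f : Vec3) : Prop :=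
  ∀ η : ℝ, 0 < η → ∃ ε₂ ν₂ : ℝ, 0 < ε₂ ∧ 0 < ν₂ ∧ ∀ ν : ℝ, 0 < ν → ν < ν₂ →
    ∀ μ : Measure H3, IsRelaxedSSS ν (lerayRadiusSq f ν) f μ → Torus.ensembleDissipation ν μ < ε₂ →
      ∫ u, Torus.pairing u.1 f ∂μ ≤ Torus.ensembleDissipation ν μ + η

/-- The input floor is NECESSARY for S5 at `f` (energy inequality). -/
theorem inputFloor_of_uniformRelaxedFloor {f : Vec3} (h : UniformRelaxedFloor f) : RelaxedInputFloor f := by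
  obtain ⟨ε₀, ν₀, hε₀, hν₀, h⟩ := h
  exact ⟨ε₀, ν₀, hε₀, hν₀, fun ν hν hνlt μ hμ => (h ν hν hνlt μ hμ).trans hμ.energy_ineq⟩

/-- **INPUT FLOOR + SMALL LEAK ⇒ S5 at `f` (PROVED glue).** With `η = ε₀/2`: a statistic dissipating `< ε₂`
injects `≤ ε(μ) + ε₀/2` yet `≥ ε₀`, so `ε(μ) ≥ ε₀/2`; otherwise `ε(μ) ≥ ε₂`. -/
theorem uniformRelaxedFloor_of_inputFloor_of_leakLittle {f : Vec3} (hI : RelaxedInputFloor f)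
    (hL : QuietStatisticsLeakLittle f) : UniformRelaxedFloor f := by
  obtain ⟨ε₀, ν₀, hε₀, hν₀, hI⟩ := hI
  obtain ⟨ε₂, ν₂, hε₂, hν₂, hL⟩ := hL (ε₀ / 2) (half_pos hε₀)
  refine ⟨min ε₂ (ε₀ / 2), min ν₀ ν₂, lt_min hε₂ (half_pos hε₀), lt_min hν₀ hν₂,
    fun ν hν hνlt μ hμ => ?_⟩
  have hν₀' : ν < ν₀ := lt_of_lt_of_le hνlt (min_le_left _ _)
  have hν₂' : ν < ν₂ := lt_of_lt_of_le hνlt (min_le_right _ _)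
  by_cases hq : Torus.ensembleDissipation ν μ < ε₂
  · have h1 := hI ν hν hν₀' μ hμ
    have h2 := hL ν hν hν₂' μ hμ hq
    exact (min_le_right _ _).trans (by linarith)
  · exact (min_le_left _ _).trans (not_lt.1 hq)

/-- Bounded-energy half of S5 at `f` (the DODGER regime): for every energy cap `E`, the relaxed statistics of
mean energy `≤ E` are uniformly loud as `ν → 0`. -/
def NoQuietBoundedEnergyStatistics (f : Vec3) : Prop :=
  ∀ E : ℝ, ∃ ε ν₁ : ℝ, 0 < ε ∧ 0 < ν₁ ∧ ∀ ν : ℝ, 0 < ν → ν < ν₁ →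
    ∀ μ : Measure H3, IsRelaxedSSS ν (lerayRadiusSq f ν) f μ → Torus.ensembleEnergy μ ≤ E →
      ε ≤ Torus.ensembleDissipation ν μ

/-- Fat half of S5 at `f` (the WARM regime): above SOME energy cap `E`, relaxed statistics are uniformly loud. -/
def NoQuietFatStatistics (f : Vec3) : Prop :=
  ∃ E ε ν₁ : ℝ, 0 < ε ∧ 0 < ν₁ ∧ ∀ ν : ℝ, 0 < ν → ν < ν₁ →
    ∀ μ : Measure H3, IsRelaxedSSS ν (lerayRadiusSq f ν) f μ → E ≤ Torus.ensembleEnergy μ →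
      ε ≤ Torus.ensembleDissipation ν μ

/-- **REGIME SPLIT of S5 at `f` (PROVED glue):** the two halves give the uniform relaxed floor of `f`. -/
theorem uniformRelaxedFloor_of_split {f : Vec3} (hb : NoQuietBoundedEnergyStatistics f)
    (hf : NoQuietFatStatistics f) : UniformRelaxedFloor f := by
  obtain ⟨E, ε₂, ν₂, hε₂, hν₂, hfat⟩ := hf
  obtain ⟨ε₁, ν₁, hε₁, hν₁, hbdd⟩ := hb E
  refine ⟨min ε₁ ε₂, min ν₁ ν₂, lt_min hε₁ hε₂, lt_min hν₁ hν₂, fun ν hν hνlt μ hμ => ?_⟩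
  rcases le_total (Torus.ensembleEnergy μ) E with hle | hge
  · exact (min_le_left _ _).trans (hbdd ν hν (lt_of_lt_of_le hνlt (min_le_left _ _)) μ hμ hle)
  · exact (min_le_right _ _).trans (hfat ν hν (lt_of_lt_of_le hνlt (min_le_right _ _)) μ hμ hge)

/-- The pinned-force shape of the line (for a lead who fixes the witness, e.g. `f_K` per the sibling line
`marchioro-force-floor` or the card's `E₁⁺` note): a uniform relaxed floor for ONE admissible force already gives
S5, without touching S0–S4. -/
theorem relaxedEnsembleFloor_of_pinned {f : Vec3} (hfs : Torus.IsSmooth f) (hfd : Torus.IsDivFree f)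
    (hfz : Torus.HasZeroMean f) (h : UniformRelaxedFloor f) : RelaxedEnsembleFloor :=
  relaxedEnsembleFloor_iff.2 ⟨f, hfs, hfd, hfz, h⟩

end Summit.AnomalousDissipation.AnomalousDissipation.Cruxes.FloorCertificate.FloorMinimaxDissipationTightness

end
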